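import Mathlib
import Summits.NavierStokesRegularity.NavierStokesRegularity.Theorems.EulerZoomLiouvillePowerGaugeEulerLiouvilleMeanStrainTools
import HarnessLib

/-!
# Crux `EulerZoomLiouville.PowerGaugeEulerLiouville` (stmt-NavierStokesRegularity-19832): tools for THE LAGRANGIAN TRACE LAW (plate t59-LT, nsreg-p2 ROUND-54) — cut-offs and cut-off independence

Width/portrait helper for THE ONE STATEMENT `stub_selfSimilarC2Needle` (LEAD skeleton `Cruxes/PowerGaugeEulerLiouville/Lines/birth.lean` v111,
ns-typeII-p2 g16), `--supports stmt-NavierStokesRegularity-19832 --as helper`.  Text custody nsreg-p2 g44 (`r54/Sketch54.lean` f78682d2f4ee3f27,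
`NsregP2.R54.Trace.LagrangianTraceLaw` over the interface `IsForwardSimilarityFlow`; keys 09:01:11Z/09:04:21Z: «ESC + MS + monotone convergence in
the horizon + CUT-OFF INDEPENDENCE on tube trajectories for a GLOBAL flow»).  This file supplies the cut-off independence:

* `exists_C2_cutoff` — for a `C²` field `V` and a radius `Rbig` there is a `C²` field `V′` with `‖DV′‖ ≤ K` and `V′ = V` on `ball 0 Rbig`
  (a bump times `V`): the lineage's cut-off idiom is always available;
* `traj_eq_flow_of_mem_ball` — a trajectory `X` of the TRUE similarity field `γy + V` (`X′ = γX + V(X)` on `s ≥ 0`) that stays in `ball 0 Rbig` on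
  `[0, T]` coincides there with the cut-off flow `Ψ′_s(X 0)` (ODE uniqueness, `ODE_solution_unique`, the cut-off field being globally Lipschitz);
* `traj_eq_flow_of_flow_stay` — the same conclusion when it is the CUT-OFF orbit `Ψ′_s(X 0)` that is known to stay in a smaller closed ball
  (first-exit argument: up to its first exit from an intermediate ball the true trajectory is inside `ball 0 Rbig`, hence equal to the cut-off orbit,
  hence not exiting);
* `continuousOn_traj` — such a trajectory is continuous on `[0, ∞)`.

HONEST FRAMING: ODE bookkeeping about HYPOTHETICAL profiles' flows; nothing about the crux E (19832 OPEN) or NS regularity is proved here.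
[nsreg-p2 R54 §C t59-LT; cite: ConstantinIgnatovaVicol2026Putative, §3.4.1 eq. (3.21)]
-/

noncomputable section

set_option linter.dupNamespace false

open MeasureTheory Set Filter Topology Metric Function
open scoped RealInnerProductSpace NNReal ENNReal ContDiff

namespace Summit.NavierStokesRegularity.NavierStokesRegularity.Theorems.PowerGaugeEulerLiouville.Trace

open Literature.Analysis Literature.Analysis.FluidPDE
open Summit.NavierStokesRegularity.NavierStokesRegularity.Theorems.PowerGaugeEulerLiouville.BernoulliLandscape
open Summit.NavierStokesRegularity.NavierStokesRegularity.Theorems.PowerGaugeEulerLiouville.NeedleFeeding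

variable {γ : ℝ} {V V' : EuclideanSpace ℝ (Fin 3) → EuclideanSpace ℝ (Fin 3)} {K Rbig : ℝ}

/-! ### The cut-off idiom is always available -/

/-- **`C²` cut-offs exist**: for a `C²` field `V` and any radius `Rbig` there is a `C²` field `V′` with globally bounded derivative which agrees
with `V` on `ball 0 Rbig` (take `V′ = χ·V` for a bump `χ` equal to `1` on `closedBall 0 Rbig`). [folklore] -/
theorem exists_C2_cutoff (hV : ContDiff ℝ 2 V) (Rbig : ℝ) (hR : 0 < Rbig) :
    ∃ (V' : EuclideanSpace ℝ (Fin 3) → EuclideanSpace ℝ (Fin 3)) (K : ℝ), ContDiff ℝ 2 V' ∧ (∀ y, ‖fderiv ℝ V' y‖ ≤ K) ∧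
      ∀ w ∈ ball (0 : EuclideanSpace ℝ (Fin 3)) Rbig, V' w = V w := by
  let χ : ContDiffBump (0 : EuclideanSpace ℝ (Fin 3)) := ⟨Rbig, Rbig + 1, hR, by linarith⟩
  have hV'c : ContDiff ℝ 2 fun y => (χ : EuclideanSpace ℝ (Fin 3) → ℝ) y • V y := χ.contDiff.smul hV
  have hsupp : HasCompactSupport fun y => (χ : EuclideanSpace ℝ (Fin 3) → ℝ) y • V y :=
    χ.hasCompactSupport.smul_right
  have hDc : Continuous (fderiv ℝ fun y => (χ : EuclideanSpace ℝ (Fin 3) → ℝ) y • V y) := hV'c.continuous_fderiv (by norm_num)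
  obtain ⟨K, hK⟩ := hDc.bounded_above_of_compact_support (hsupp.fderiv (𝕜 := ℝ))
  refine ⟨fun y => (χ : EuclideanSpace ℝ (Fin 3) → ℝ) y • V y, K, hV'c, hK, fun w hw => ?_⟩
  have h1 : (χ : EuclideanSpace ℝ (Fin 3) → ℝ) w = 1 := χ.one_of_mem_closedBall (ball_subset_closedBall hw)
  simp only [h1, one_smul]

/-! ### Cut-off independence on tube trajectories -/

/-- A trajectory of the similarity field with `X′(s) = γX(s) + V(X(s))` for `s ≥ 0` is continuous on `[0, T]`. [folklore] -/
theorem continuousOn_traj {X : ℝ → EuclideanSpace ℝ (Fin 3)}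
    (hX : ∀ s : ℝ, 0 ≤ s → HasDerivAt X (γ • X s + V (X s)) s) (T : ℝ) : ContinuousOn X (Icc 0 T) :=
  fun s hs => (hX s hs.1).continuousAt.continuousWithinAt

/-- A trajectory of the similarity field with `X′(s) = γX(s) + V(X(s))` for `s ≥ 0` is continuous on `[0, ∞)`. [folklore] -/
theorem continuousOn_traj_Ici {X : ℝ → EuclideanSpace ℝ (Fin 3)}
    (hX : ∀ s : ℝ, 0 ≤ s → HasDerivAt X (γ • X s + V (X s)) s) : ContinuousOn X (Ici 0) :=
  fun s hs => (hX s hs).continuousAt.continuousWithinAt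

/-- **Cut-off independence, I.**  If a trajectory `X` of the true field (`X′ = γX + V(X)` on `s ≥ 0`) stays in `ball 0 Rbig` on `[0, T]`, where
`V′ = V`, then it coincides on `[0, T]` with the cut-off flow of `γy + V′` started at `X 0` (ODE uniqueness; the cut-off field is globally
Lipschitz). [cite: ConstantinIgnatovaVicol2026Putative, §3.4.1 eq. (3.21)] -/
theorem traj_eq_flow_of_mem_ball (hV' : ContDiff ℝ 2 V') (hK : ∀ y, ‖fderiv ℝ V' y‖ ≤ K)
    (hVV' : ∀ w ∈ ball (0 : EuclideanSpace ℝ (Fin 3)) Rbig, V' w = V w)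
    {X : ℝ → EuclideanSpace ℝ (Fin 3)} (hX : ∀ s : ℝ, 0 ≤ s → HasDerivAt X (γ • X s + V (X s)) s) {T : ℝ}
    (hin : ∀ s ∈ Icc 0 T, X s ∈ ball (0 : EuclideanSpace ℝ (Fin 3)) Rbig) :
    ∀ s ∈ Icc 0 T, X s = ODE.evolutionMap (fun _ : ℝ => selfSimilarTransport γ 0 V') 0 s (X 0) := by
  have hV1 : ContDiff ℝ 1 V' := hV'.of_le (by norm_num)
  have hLip := C2.Kelvin.lipschitzWith_selfSimilarTransport (γ := γ) hV1 hK
  have hf' : ∀ t ∈ Ico 0 T, HasDerivWithinAt X (selfSimilarTransport γ 0 V' (X t)) (Ici t) t := by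
    intro t ht
    have h := hX t ht.1
    have e : γ • X t + V (X t) = selfSimilarTransport γ 0 V' (X t) := by
      rw [selfSimilarTransport, sub_zero, hVV' _ (hin t ⟨ht.1, ht.2.le⟩)]
    rw [e] at h
    exact h.hasDerivWithinAt
  have hg : ContinuousOn (fun s => ODE.evolutionMap (fun _ : ℝ => selfSimilarTransport γ 0 V') 0 s (X 0)) (Icc 0 T) :=
    (C2.Kelvin.continuous_flow_apply (γ := γ) hV1 hK (X 0)).continuousOn
  have hg' : ∀ t ∈ Ico 0 T, HasDerivWithinAt (fun s => ODE.evolutionMap (fun _ : ℝ => selfSimilarTransport γ 0 V') 0 s (X 0))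
      (selfSimilarTransport γ 0 V' (ODE.evolutionMap (fun _ : ℝ => selfSimilarTransport γ 0 V') 0 t (X 0))) (Ici t) t :=
    fun t _ => (C2.Kelvin.hasDerivAt_flow (γ := γ) hV1 hK t (X 0)).hasDerivWithinAt
  have h0 : X 0 = ODE.evolutionMap (fun _ : ℝ => selfSimilarTransport γ 0 V') 0 0 (X 0) := (ODE.evolutionMap_self _ 0 (X 0)).symm
  exact ODE_solution_unique (v := fun _ => selfSimilarTransport γ 0 V') (fun _ => hLip) (continuousOn_traj (γ := γ) hX T) hf' hg hg' h0

/-- **Cut-off independence, II (first-exit argument).**  If the CUT-OFF orbit `Ψ′_s(X 0)` stays in `closedBall 0 R₁` on `[0, T]` with `R₁ < Rbig`,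
then the true trajectory `X` coincides with it on `[0, T]`: up to its first exit from the intermediate ball of radius `(R₁+Rbig)/2` the true trajectory
lies in `ball 0 Rbig`, hence equals the cut-off orbit there, hence has not exited. [cite: ConstantinIgnatovaVicol2026Putative, §3.4.1 eq. (3.21)] -/
theorem traj_eq_flow_of_flow_stay (hV' : ContDiff ℝ 2 V') (hK : ∀ y, ‖fderiv ℝ V' y‖ ≤ K)
    (hVV' : ∀ w ∈ ball (0 : EuclideanSpace ℝ (Fin 3)) Rbig, V' w = V w)
    {X : ℝ → EuclideanSpace ℝ (Fin 3)} (hX : ∀ s : ℝ, 0 ≤ s → HasDerivAt X (γ • X s + V (X s)) s) {T R₁ : ℝ} (hT : 0 ≤ T)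
    (hR₁ : R₁ < Rbig)
    (hstay : ∀ s ∈ Icc 0 T, ‖ODE.evolutionMap (fun _ : ℝ => selfSimilarTransport γ 0 V') 0 s (X 0)‖ ≤ R₁) :
    ∀ s ∈ Icc 0 T, X s = ODE.evolutionMap (fun _ : ℝ => selfSimilarTransport γ 0 V') 0 s (X 0) := by
  set R₂ : ℝ := (R₁ + Rbig) / 2 with hR₂
  have h12 : R₁ < R₂ := by rw [hR₂]; linarith
  have h2b : R₂ < Rbig := by rw [hR₂]; linarith
  have hXc : ContinuousOn X (Icc 0 T) := continuousOn_traj (γ := γ) hX T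
  have hX0 : ‖X 0‖ ≤ R₁ := by
    have := hstay 0 ⟨le_rfl, hT⟩
    rwa [ODE.evolutionMap_self] at this
  -- the exit set
  obtain ⟨E, hE⟩ : ∃ E : Set ℝ, E = Icc 0 T ∩ X ⁻¹' {w | R₂ ≤ ‖w‖} := ⟨_, rfl⟩
  have hEc : IsClosed E := hE ▸ hXc.preimage_isClosed_of_isClosed isClosed_Icc (isClosed_le continuous_const continuous_norm)
  by_cases hne : E.Nonempty
  · -- first exit time `s₁`, and a contradiction
    exfalso
    have hbdd : BddBelow E := ⟨0, fun s hs => (hE ▸ hs).1.1⟩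
    set s₁ := sInf E with hs₁
    have hs₁E : s₁ ∈ E := hEc.csInf_mem hne hbdd
    have hs₁' := hE ▸ hs₁E
    have hlt : ∀ s, 0 ≤ s → s < s₁ → ‖X s‖ < R₂ := by
      intro s hs0 hss
      by_contra h
      push Not at h
      have hsE : s ∈ E := hE ▸ ⟨⟨hs0, hss.le.trans hs₁'.1.2⟩, h⟩
      exact absurd (csInf_le hbdd hsE) (not_le.2 hss)
    have hs₁pos : 0 < s₁ := by
      rcases eq_or_lt_of_le hs₁'.1.1 with h0 | h0
      · exfalso
        have h : R₂ ≤ ‖X s₁‖ := hs₁'.2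
        rw [← h0] at h
        linarith
      · exact h0
    -- on `[0, s₁]` the trajectory is inside `ball 0 Rbig` (closure of `[0, s₁)` for the `≤ R₂` bound)
    have hle : ∀ s ∈ Icc 0 s₁, ‖X s‖ ≤ R₂ := by
      have hZ : IsClosed (Icc 0 T ∩ X ⁻¹' {w | ‖w‖ ≤ R₂}) :=
        hXc.preimage_isClosed_of_isClosed isClosed_Icc (isClosed_le continuous_norm continuous_const)
      have hsub : Ico 0 s₁ ⊆ Icc 0 T ∩ X ⁻¹' {w | ‖w‖ ≤ R₂} := fun s hs =>
        ⟨⟨hs.1, hs.2.le.trans hs₁'.1.2⟩, (hlt s hs.1 hs.2).le⟩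
      have hcl := hZ.closure_subset_iff.2 hsub
      rw [closure_Ico hs₁pos.ne] at hcl
      exact fun s hs => (hcl hs).2
    have hin : ∀ s ∈ Icc 0 s₁, X s ∈ ball (0 : EuclideanSpace ℝ (Fin 3)) Rbig := fun s hs => by
      rw [mem_ball_zero_iff]; exact lt_of_le_of_lt (hle s hs) h2b
    have heq := traj_eq_flow_of_mem_ball (γ := γ) hV' hK hVV' hX hin s₁ ⟨hs₁pos.le, le_rfl⟩
    have h1 : ‖X s₁‖ ≤ R₁ := by rw [heq]; exact hstay s₁ ⟨hs₁pos.le, hs₁'.1.2⟩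
    have h2 : R₂ ≤ ‖X s₁‖ := hs₁'.2
    linarith
  · -- no exit: the trajectory stays in `ball 0 Rbig` on `[0, T]`
    have hin : ∀ s ∈ Icc 0 T, X s ∈ ball (0 : EuclideanSpace ℝ (Fin 3)) Rbig := by
      intro s hs
      rw [mem_ball_zero_iff]
      by_contra h
      push Not at h
      exact hne ⟨s, hE ▸ ⟨hs, h2b.le.trans h⟩⟩
    exact traj_eq_flow_of_mem_ball (γ := γ) hV' hK hVV' hX hin

end Summit.NavierStokesRegularity.NavierStokesRegularity.Theorems.PowerGaugeEulerLiouville.Trace
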